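import Literature.Dynamics.Contraction.ComplexConeContraction

/-!
# Dubois 2009, Lemma 2.1 (formula (2.9)) and Theorem 1.1 / Proposition 3.3 — proofs

Discharges two named facts of `Literature/Dynamics/Contraction/ComplexConeContraction.lean`
(statements unchanged there), following the printed proofs of

* L. Dubois, *Projective metrics and contraction principles for complex cones*, J. London Math.
  Soc. (2) 79 (2009) 719–737 = arXiv:0811.2930 [Dubois2009] (read 2026-08-15 on the held arXiv
  text):

1. `Dubois2009_lemma_2_1_holds : Dubois2009_lemma_2_1` — Lemma 2.1, formula (2.9), p. 5
   (section `Lemma21Proof`).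
2. `Dubois2009_thm_1_1_iff_holds : Dubois2009_thm_1_1_iff` — Theorem 1.1 (first assertion) =
   Proposition 3.3, p. 10: a complex `n × n` matrix `A` maps `ℂⁿ₊ ∖ 0` into `Int ℂⁿ₊` ((3.19))
   iff `|a_kp a_lq − a_kq a_lp| < Re(conj(a_kp) a_lq + conj(a_kq) a_lp)` for all `k, l, p, q`
   ((3.20)) (section `ProofOfProp33`, which documents how the printed proof — Lemma 3.1 and the
   discs (3.21) of Lemma 3.2 — is rendered).

## References
* [Dubois2009] L. Dubois, J. London Math. Soc. (2) 79 (2009) 719–737 = arXiv:0811.2930,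
  Lemma 2.1, (2.8), (2.9), p. 5; Lemma 3.1 ((3.16)), Lemma 3.2 ((3.17)–(3.18)), Proposition 3.3
  ((3.19)–(3.21)), pp. 9–10; Theorem 1.1 (p. 2).
-/

noncomputable section

open scoped ENNReal ComplexConjugate
open Set

namespace Literature.Dynamics.Contraction

/-! ### Proof of Lemma 2.1, formula (2.9) (Dubois 2009, p. 5)

The printed proof (p. 5): by the characterisation (2.8) `x ∈ C ↔ ∀ f ∈ C', ⟨f,x⟩ ≠ 0`,
`z x − y ∉ C` iff `⟨f, z x − y⟩ = 0` for some `f ∈ C'`, so that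
`E_C(x,y) = {⟨f,y⟩/⟨f,x⟩ : f ∈ C'}`; this gives (2.9). We follow it literally: (2.8) is
`mem_iff_forall_dualComplement`, the display is `duboisE_eq_image_dualComplement`, and the
passage from `log (sup |E| / inf |E|)` to the double supremum is order bookkeeping in `ℝ≥0∞`
(`ENNReal.inv_iInf`, `ENNReal.mul_iSup`) pushed through the order isomorphism `ENNReal.log`.
The colinear case `y = a • x` is the first clause of Def. 2 (every cross-ratio equals `1`).
Properness and completeness are not used for (2.9) (print uses properness only to get
`E ≠ ∅`, which here follows from `C' ≠ ∅`, itself a consequence of `C ≠ V`). -/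

section Lemma21Proof

variable {W : Type*} [NormedAddCommGroup W] [NormedSpace ℂ W]

/-- (2.8): for a linearly convex cone, `w ∈ C ↔ ∀ f ∈ C', ⟨f,w⟩ ≠ 0`.
[cite: Dubois2009, (2.8)] -/
theorem mem_iff_forall_dualComplement {C : Set W} (hC : IsLinearlyConvex C) (w : W) :
    w ∈ C ↔ ∀ f ∈ dualComplement C, f w ≠ 0 := by
  refine ⟨fun hw f hf => hf w hw, fun h => ?_⟩
  by_contra hw
  obtain ⟨f, hf0, hfC⟩ := hC w hw
  exact h f hfC hf0

/-- If `C` is linearly convex and `C ≠ V` then `0 ∉ C` (Dubois 2009, remark after (2.7)).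
[cite: Dubois2009, p. 5] -/
theorem zero_notMem_of_isLinearlyConvex {C : Set W} (hC : IsLinearlyConvex C)
    (hCV : C ≠ Set.univ) : (0 : W) ∉ C := by
  obtain ⟨w, hw⟩ := (Set.ne_univ_iff_exists_notMem C).mp hCV
  obtain ⟨f, -, hfC⟩ := hC w hw
  exact fun h0 => hfC 0 h0 (map_zero f)

/-- If `C` is linearly convex and `C ≠ V` then the dual complement `C'` is non-empty.
[cite: Dubois2009, p. 5] -/
theorem dualComplement_nonempty {C : Set W} (hC : IsLinearlyConvex C) (hCV : C ≠ Set.univ) :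
    (dualComplement C).Nonempty := by
  obtain ⟨w, hw⟩ := (Set.ne_univ_iff_exists_notMem C).mp hCV
  obtain ⟨f, -, hfC⟩ := hC w hw
  exact ⟨f, hfC⟩

/-- The display in the proof of Lemma 2.1: `E_C(x,y) = {⟨f,y⟩/⟨f,x⟩ : f ∈ C'}` for `x ∈ C`.
[cite: Dubois2009, proof of Lemma 2.1] -/
theorem duboisE_eq_image_dualComplement {C : Set W} (hC : IsLinearlyConvex C) {x : W}
    (hx : x ∈ C) (y : W) :
    duboisE C x y = (fun f : W →L[ℂ] ℂ => f y / f x) '' dualComplement C := by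
  ext z
  simp only [duboisE, Set.mem_setOf_eq, Set.mem_image]
  rw [mem_iff_forall_dualComplement hC]
  push Not
  constructor
  · rintro ⟨f, hf, hfz⟩
    refine ⟨f, hf, ?_⟩
    have hx0 : f x ≠ 0 := hf x hx
    rw [map_sub, map_smul, smul_eq_mul] at hfz
    rw [div_eq_iff hx0]
    linear_combination (-1 : ℂ) * hfz
  · rintro ⟨f, hf, rfl⟩
    refine ⟨f, hf, ?_⟩
    have hx0 : f x ≠ 0 := hf x hx
    rw [map_sub, map_smul, smul_eq_mul, div_mul_cancel₀ _ hx0, sub_self]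

/-- For nonzero complex numbers, `log (|z| / |w|)` computed through `ℝ≥0∞ → EReal` is the real
logarithm. [folklore] -/
theorem ennreal_log_nnnorm_div {z w : ℂ} (hz : z ≠ 0) (hw : w ≠ 0) :
    ENNReal.log ((‖z‖₊ : ℝ≥0∞) / (‖w‖₊ : ℝ≥0∞)) = ((Real.log (‖z‖ / ‖w‖) : ℝ) : EReal) := by
  have hz' : ‖z‖₊ ≠ 0 := by simpa using hz
  have hw' : ‖w‖₊ ≠ 0 := by simpa using hw
  rw [← ENNReal.coe_div hw', ENNReal.log_of_nnreal (div_ne_zero hz' hw')]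
  simp

/-- `sup / inf = sup sup (· / ·)` in `ℝ≥0∞`. [folklore] -/
theorem biSup_div_biInf_ennreal {ι : Type*} (s : Set ι) (u : ι → ℝ≥0∞) :
    (⨆ i ∈ s, u i) / (⨅ i ∈ s, u i) = ⨆ i ∈ s, ⨆ j ∈ s, u i / u j := by
  rw [div_eq_mul_inv]
  simp_rw [ENNReal.inv_iInf, ENNReal.iSup_mul, ENNReal.mul_iSup, div_eq_mul_inv]

/-- `ENNReal.log` commutes with (double, bounded) suprema, being an order isomorphism.
[folklore] -/
theorem ennreal_log_biSup₂ {ι : Type*} (s : Set ι) (F : ι → ι → ℝ≥0∞) :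
    ENNReal.log (⨆ i ∈ s, ⨆ j ∈ s, F i j) = ⨆ i ∈ s, ⨆ j ∈ s, ENNReal.log (F i j) := by
  simp_rw [← ENNReal.logOrderIso_apply, OrderIso.map_iSup]

/-- **Dubois 2009, Lemma 2.1, formula (2.9)** — discharge of `Dubois2009_lemma_2_1`, following
the printed proof (p. 5). [cite: Dubois2009, Lemma 2.1, (2.9), p. 5] -/
theorem Dubois2009_lemma_2_1_holds : Dubois2009_lemma_2_1 := by
  intro V _ _ _ C _ hconv hCV x hx y hy
  classical
  have h0 : (0 : V) ∉ C := zero_notMem_of_isLinearlyConvex hconv hCV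
  have hne : (dualComplement C).Nonempty := dualComplement_nonempty hconv hCV
  have hx0 : x ≠ 0 := fun h => h0 (h ▸ hx)
  by_cases hli : LinearIndependent ℂ ![x, y]
  · -- independent case: `E = {f y / f x}` and order bookkeeping
    rw [duboisDelta, if_pos hli, duboisE_eq_image_dualComplement hconv hx y,
      biSup_div_biInf_ennreal, ennreal_log_biSup₂, iSup_image]
    refine biSup_congr fun f hf => ?_
    rw [iSup_image]
    refine biSup_congr fun g hg => ?_
    have hfx : f x ≠ 0 := hf x hx
    have hfy : f y ≠ 0 := hf y hy
    have hgx : g x ≠ 0 := hg x hx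
    have hgy : g y ≠ 0 := hg y hy
    rw [ennreal_log_nnnorm_div (div_ne_zero hfy hfx) (div_ne_zero hgy hgx), ← norm_div]
    congr 3
    field_simp
  · -- colinear case: `y = a • x`, every cross-ratio is `1`
    rw [duboisDelta, if_neg hli]
    obtain ⟨a, rfl⟩ : ∃ a : ℂ, a • x = y := by
      by_contra h
      push Not at h
      exact hli ((LinearIndependent.pair_iff' hx0).mpr h)
    have key : ∀ f ∈ dualComplement C, ∀ g ∈ dualComplement C,
        ((Real.log ‖f (a • x) * g x / (f x * g (a • x))‖ : ℝ) : EReal) = 0 := by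
      intro f hf g hg
      have hfx : f x ≠ 0 := hf x hx
      have hgx : g x ≠ 0 := hg x hx
      have hfy : f (a • x) ≠ 0 := hf _ hy
      have ha : a ≠ 0 := by
        rintro rfl
        exact hfy (by simp)
      have h1 : f (a • x) * g x / (f x * g (a • x)) = 1 := by
        rw [map_smul, map_smul, smul_eq_mul, smul_eq_mul]
        field_simp
      rw [h1, norm_one, Real.log_one, EReal.coe_zero]
    rw [biSup_congr fun f hf => biSup_congr fun g hg => key f hf g hg]
    simp_rw [biSup_const hne]

end Lemma21Proof

/-! ### Proof of Theorem 1.1 (first assertion) = Proposition 3.3 (Dubois 2009, p. 10)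

The printed proof rests on Lemma 3.1 (linear convexity of `ℂⁿ₊ ∖ 0` / `Int ℂⁿ₊`:
`x ∈ Int ℂⁿ₊ ⟺ ⟨y,x⟩ ≠ 0` for all `y ∈ ℂⁿ₊ ∖ 0`) and Lemma 3.2 (for `x ∈ Int ℂⁿ₊` the set
`E_{Int ℂⁿ₊}(x,y) = {z : z x − y ∉ Int ℂⁿ₊}` is the union of the closed discs `D̄_pq(x,y)` with
centre `c_pq = (x̄_q y_p + x̄_p y_q) / (2 Re(x_p x̄_q))` and radius
`r_pq = |x_q y_p − x_p y_q| / (2 Re(x_p x̄_q))`, (3.17)/(3.21), `duboisE_rughConeInt_eq_iUnion` in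
the statement file): the values `⟨λ_l,v⟩/⟨λ_k,v⟩`, `v ∈ ℂⁿ₊ ∖ 0`, are exactly the points of
`E_{Int ℂⁿ₊}(λ_k,λ_l)` (rows `λ_j`, which lie in `Int ℂⁿ₊`), and (3.20) says exactly
`Re c_pq > r_pq`, i.e. every disc lies in the open right half-plane. Rendering choices (same
mathematics, shorter road in Lean; only the elementary inequality (3.18) of Lemma 3.2 is used, in
real coordinates, so this section does not depend on the `Discs` section of the statement file):
* (3.20) ⟹ (3.19) (`mapsTo_of_cond`): rows `λ_k ∈ Int ℂⁿ₊` by the case `k = l` of (3.20);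
  `X = ⟨λ_k,v⟩ ≠ 0` by Lemma 3.1; with `z = ⟨λ_l,v⟩ / X` the vector `z λ_k − λ_l` is orthogonal
  to `v`, hence not in `Int ℂⁿ₊` (Lemma 3.1 again), i.e. `z` lies in some disc `D̄_pq`, whence
  `Re z > 0` (`re_pos_of_mem_disc`) and `Re(X · conj ⟨λ_l,v⟩) = |X|² Re z > 0`.
* The half of Lemma 3.1 needed in full generality (`x ∈ Int ℂⁿ₊`, `v ∈ ℂⁿ₊ ∖ 0` ⟹ `⟨x,v⟩ ≠ 0`,
  `sum_mul_ne_zero_of_mem_rughConeInt`) is proved by choosing extremal-argument coordinates of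
  `x` and `v` (a finite total preorder has a greatest element) and rotating by them, instead of
  the paper's rotation of all coordinates into quadrants.
* (3.19) ⟹ (3.20) (`cond_of_pair`): the other half of Lemma 3.1 and Lemma 3.2 are only needed
  on the two coordinates `p, q`, where they amount to evaluating (3.19) on the test vectors
  `α e_p + β e_q ∈ ℂⁿ₊ ∖ 0` (`Re(α β̄) ≥ 0`): `(α,β) = (x_q, −x_p)` gives `Re(x_p x̄_q) > 0`;
  `(α,β) = (2a y_q − G x_q, G x_p − 2a y_p)` realises the value `z = G/2a` of
  `⟨λ_l,v⟩/⟨λ_k,v⟩`, used with `G = E` (the centre: `Re c_pq > 0`) and `G = i Im E`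
  (`(Re c_pq)² > r_pq²`); here `x = λ_k`, `y = λ_l`, `a = Re(x_p x̄_q)`,
  `E = x̄_p y_q + x̄_q y_p = 2a c_pq`, `D = x_p y_q − x_q y_p`, `|D| = 2a r_pq`, and
  `|D|² = |E|² − 4 a Re(y_p ȳ_q)`.
-/

section ProofOfProp33

/-- A total transitive relation on a nonempty finset has a greatest element. [folklore] -/
private theorem exists_greatest_of_total {ι : Type*} (R : ι → ι → Prop) (s : Finset ι)
    (hs : s.Nonempty) (htot : ∀ a ∈ s, ∀ b ∈ s, R a b ∨ R b a)
    (htrans : ∀ a ∈ s, ∀ b ∈ s, ∀ c ∈ s, R a b → R b c → R a c) :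
    ∃ m ∈ s, ∀ a ∈ s, R a m := by
  classical
  induction s using Finset.induction_on with
  | empty => exact absurd hs Finset.not_nonempty_empty
  | insert a s _ ih =>
    have ha : a ∈ insert a s := Finset.mem_insert_self a s
    rcases s.eq_empty_or_nonempty with hse | hsne
    · subst hse
      refine ⟨a, ha, fun b hb => ?_⟩
      have hb' : b = a := by simpa using hb
      subst hb'
      exact (htot b hb b hb).elim id id
    · obtain ⟨m, hm, hmax⟩ := ih hsne
        (fun a ha b hb => htot a (Finset.mem_insert_of_mem ha) b (Finset.mem_insert_of_mem hb))
        (fun a ha b hb c hc => htrans a (Finset.mem_insert_of_mem ha) b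
          (Finset.mem_insert_of_mem hb) c (Finset.mem_insert_of_mem hc))
      have hm' : m ∈ insert a s := Finset.mem_insert_of_mem hm
      rcases htot a ha m hm' with h | h
      · refine ⟨m, hm', fun b hb => ?_⟩
        rcases Finset.mem_insert.1 hb with rfl | hb
        · exact h
        · exact hmax b hb
      · refine ⟨a, ha, fun b hb => ?_⟩
        rcases Finset.mem_insert.1 hb with rfl | hb
        · exact (htot b ha b ha).elim id id
        · exact htrans b (Finset.mem_insert_of_mem hb) m hm' a ha (hmax b hb) h

/-- In `ℂⁿ₊` the relation "`0 ≤ Im(v_a conj v_b)`" (the argument of `v_a` is at least that of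
`v_b`) is transitive through nonzero coordinates. [folklore] -/
private theorem im_nonneg_trans {n : ℕ} {v : Fin n → ℂ} (hv : v ∈ rughCone n) {a b c : Fin n}
    (hb : v b ≠ 0) (hab : 0 ≤ (v a * conj (v b)).im) (hbc : 0 ≤ (v b * conj (v c)).im) :
    0 ≤ (v a * conj (v c)).im := by
  have key : (v a * conj (v b)) * (v b * conj (v c)) =
      (Complex.normSq (v b) : ℂ) * (v a * conj (v c)) := by
    rw [← Complex.mul_conj]; ring
  have h := congrArg Complex.im key
  rw [Complex.mul_im, Complex.im_ofReal_mul] at h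
  have hP := hv a b
  have hQ := hv b c
  have hpos : 0 < Complex.normSq (v b) := Complex.normSq_pos.2 hb
  by_contra hneg
  push Not at hneg
  have : Complex.normSq (v b) * (v a * conj (v c)).im < 0 := mul_neg_of_pos_of_neg hpos hneg
  nlinarith [mul_nonneg hP hbc, mul_nonneg hab hQ]

/-- **Dubois 2009, Lemma 3.1** (the half used here): if `x ∈ Int ℂⁿ₊` and `v ∈ ℂⁿ₊ ∖ 0` then
`⟨x,v⟩ = ∑ x_p v_p ≠ 0`. [cite: Dubois2009, Lemma 3.1, (3.16)] -/
theorem sum_mul_ne_zero_of_mem_rughConeInt {n : ℕ} {x v : Fin n → ℂ} (hx : x ∈ rughConeInt n)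
    (hv : v ∈ rughCone n) (hv0 : v ≠ 0) : ∑ p, x p * v p ≠ 0 := by
  classical
  -- `q₁`: a nonzero coordinate of `v` of least argument
  obtain ⟨q₁, hq₁, hqmax⟩ : ∃ q₁, v q₁ ≠ 0 ∧ ∀ q, 0 ≤ (v q * conj (v q₁)).im := by
    have hs : (Finset.univ.filter fun q => v q ≠ 0).Nonempty := by
      by_contra hs
      apply hv0
      funext q
      by_contra hq
      exact hs ⟨q, by simpa using hq⟩
    obtain ⟨m, hm, hmax⟩ := exists_greatest_of_total (fun a b => 0 ≤ (v a * conj (v b)).im) _ hs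
      (fun a _ b _ => by
        have e : (v a * conj (v b)).im = -(v b * conj (v a)).im := by
          simp only [Complex.mul_im, Complex.conj_re, Complex.conj_im]; ring
        rcases le_total 0 ((v a * conj (v b)).im) with h | h
        · exact Or.inl h
        · exact Or.inr (by linarith))
      (fun a _ b hb c _ hab hbc => im_nonneg_trans hv (by simpa using hb) hab hbc)
    refine ⟨m, by simpa using hm, fun q => ?_⟩
    by_cases hq : v q = 0
    · simp [hq]
    · exact hmax q (by simpa using hq)
  -- `p₂`: a coordinate of `x` of greatest argument
  obtain ⟨p₂, hpmax⟩ : ∃ p₂, ∀ p, (x p * conj (x p₂)).im ≤ 0 := by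
    obtain ⟨m, -, hmax⟩ := exists_greatest_of_total (fun a b => 0 ≤ (x b * conj (x a)).im)
      Finset.univ ⟨q₁, Finset.mem_univ _⟩
      (fun a _ b _ => by
        have e : (x a * conj (x b)).im = -(x b * conj (x a)).im := by
          simp only [Complex.mul_im, Complex.conj_re, Complex.conj_im]; ring
        rcases le_total 0 ((x a * conj (x b)).im) with h | h
        · exact Or.inr h
        · exact Or.inl (by linarith))
      (fun a _ b _ c _ hab hbc =>
        im_nonneg_trans (rughConeInt_subset n hx)
          (fun hb => by simpa [hb] using hx b b) hbc hab)
    refine ⟨m, fun p => ?_⟩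
    have h1 := hmax p (Finset.mem_univ _)
    have e : (x p * conj (x m)).im = -(x m * conj (x p)).im := by
      simp only [Complex.mul_im, Complex.conj_re, Complex.conj_im]; ring
    linarith
  -- after rotating by `conj (x p₂) * conj (v q₁)` every term has non-negative real part,
  -- and the `q₁`-th term has positive real part
  intro hS0
  have key : 0 < (conj (x p₂) * conj (v q₁) * ∑ p, x p * v p).re := by
    rw [Finset.mul_sum, Complex.re_sum]
    apply Finset.sum_pos'
    · intro p _
      have e : conj (x p₂) * conj (v q₁) * (x p * v p) =
          (x p * conj (x p₂)) * (v p * conj (v q₁)) := by ring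
      rw [e, Complex.mul_re]
      nlinarith [mul_nonneg (hx p p₂).le (hv p q₁), hpmax p, hqmax p,
        mul_nonneg (neg_nonneg.2 (hpmax p)) (hqmax p)]
    · refine ⟨q₁, Finset.mem_univ _, ?_⟩
      have e : conj (x p₂) * conj (v q₁) * (x q₁ * v q₁) =
          (x q₁ * conj (x p₂)) * (v q₁ * conj (v q₁)) := by ring
      have hre : (v q₁ * conj (v q₁)).re = Complex.normSq (v q₁) := by
        rw [Complex.mul_conj, Complex.ofReal_re]
      have him : (v q₁ * conj (v q₁)).im = 0 := by
        rw [Complex.mul_conj, Complex.ofReal_im]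
      rw [e, Complex.mul_re, hre, him, mul_zero, sub_zero]
      exact mul_pos (hx q₁ p₂) (Complex.normSq_pos.2 hq₁)
  rw [hS0, mul_zero, Complex.zero_re] at key
  exact lt_irrefl _ key

/-- The rows of a matrix satisfying (3.20) lie in `Int ℂⁿ₊` (case `k = l` of (3.20)).
[cite: Dubois2009, proof of Prop. 3.3, last sentence] -/
private theorem row_mem_rughConeInt {n : ℕ} {A : Matrix (Fin n) (Fin n) ℂ}
    (h : ∀ k l p q, ‖A k p * A l q - A k q * A l p‖ <
      (conj (A k p) * A l q + conj (A k q) * A l p).re)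
    (k : Fin n) : A k ∈ rughConeInt n := by
  intro p q
  have h1 := h k k p q
  rw [mul_comm (A k p) (A k q), sub_self, norm_zero] at h1
  simp only [Complex.add_re, Complex.mul_re, Complex.conj_re, Complex.conj_im] at h1 ⊢
  linarith

/-- The disc computation of **Lemma 3.2 / (3.21)**: if `Re((z x_p − y_p) conj(z x_q − y_q)) ≤ 0`
(i.e. `z ∈ D̄_pq(x,y)`), `Re(x_p x̄_q) > 0` and (3.20) holds for these four entries, then
`Re z > 0`. [cite: Dubois2009, Lemma 3.2, (3.17), (3.21)] -/
private theorem re_pos_of_mem_disc {xp xq yp yq z : ℂ} (ha : 0 < (xp * conj xq).re)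
    (h320 : ‖xp * yq - xq * yp‖ < (conj xp * yq + conj xq * yp).re)
    (hz : ((z * xp - yp) * conj (z * xq - yq)).re ≤ 0) : 0 < z.re := by
  have hE : 0 < (conj xp * yq + conj xq * yp).re := (norm_nonneg _).trans_lt h320
  have hsq : ‖xp * yq - xq * yp‖ ^ 2 < (conj xp * yq + conj xq * yp).re ^ 2 :=
    pow_lt_pow_left₀ h320 (norm_nonneg _) two_ne_zero
  set a : ℝ := (xp * conj xq).re with ha_def
  set d : ℝ := (yp * conj yq).re with hd_def
  set Er : ℝ := (conj xp * yq + conj xq * yp).re with hEr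
  set Ei : ℝ := (conj xp * yq + conj xq * yp).im with hEi
  have h1 : ((z * xp - yp) * conj (z * xq - yq)).re =
      a * (z.re ^ 2 + z.im ^ 2) - (z.re * Er + z.im * Ei) + d := by
    simp only [ha_def, hd_def, hEr, hEi, Complex.mul_re, Complex.mul_im, Complex.add_re,
      Complex.add_im, Complex.sub_re, Complex.sub_im, Complex.conj_re, Complex.conj_im]
    ring
  have h2 : ‖xp * yq - xq * yp‖ ^ 2 = Er ^ 2 + Ei ^ 2 - 4 * a * d := by
    rw [Complex.sq_norm, Complex.normSq_apply]
    simp only [ha_def, hd_def, hEr, hEi, Complex.mul_re, Complex.mul_im, Complex.add_re,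
      Complex.add_im, Complex.sub_re, Complex.sub_im, Complex.conj_re, Complex.conj_im]
    ring
  rw [h1] at hz
  rw [h2] at hsq
  by_contra hzre
  push Not at hzre
  nlinarith [sq_nonneg (2 * a * z.im - Ei), mul_nonneg (mul_nonneg ha.le (neg_nonneg.2 hzre)) hE.le,
    sq_nonneg (a * z.re), mul_le_mul_of_nonneg_left hz ha.le]

/-- (3.20) ⟹ (3.19). [cite: Dubois2009, Prop. 3.3] -/
private theorem mapsTo_of_cond {n : ℕ} {A : Matrix (Fin n) (Fin n) ℂ}
    (h : ∀ k l p q, ‖A k p * A l q - A k q * A l p‖ <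
      (conj (A k p) * A l q + conj (A k q) * A l p).re) :
    ∀ v ∈ rughCone n, v ≠ 0 → A.mulVec v ∈ rughConeInt n := by
  intro v hv hv0 k l
  have hx := row_mem_rughConeInt h k
  have hmv : ∀ i, A.mulVec v i = ∑ p, A i p * v p := fun i => rfl
  rw [hmv k, hmv l]
  set X := ∑ p, A k p * v p with hXdef
  set Y := ∑ p, A l p * v p with hYdef
  have hX : X ≠ 0 := sum_mul_ne_zero_of_mem_rughConeInt hx hv hv0
  set z : ℂ := Y / X with hz
  have hYz : Y = z * X := by rw [hz, div_mul_cancel₀ Y hX]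
  -- `u = z • λ_k − λ_l` is orthogonal to `v`, hence not in `Int ℂⁿ₊` (Lemma 3.1)
  have hu : (fun p => z * A k p - A l p) ∉ rughConeInt n := by
    intro hu
    apply sum_mul_ne_zero_of_mem_rughConeInt hu hv hv0
    show ∑ p, (z * A k p - A l p) * v p = 0
    calc ∑ p, (z * A k p - A l p) * v p = z * X - Y := by
          rw [hXdef, hYdef, Finset.mul_sum, ← Finset.sum_sub_distrib]
          exact Finset.sum_congr rfl fun p _ => by ring
      _ = 0 := by rw [hYz, sub_self]
  obtain ⟨p, q, hpq⟩ : ∃ p q, ((z * A k p - A l p) * conj (z * A k q - A l q)).re ≤ 0 := by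
    by_contra hcon
    push Not at hcon
    exact hu fun p q => hcon p q
  have hzre : 0 < z.re := re_pos_of_mem_disc (hx p q) (h k l p q) hpq
  have e : X * conj Y = (Complex.normSq X : ℂ) * conj z := by
    rw [hYz, map_mul, ← Complex.mul_conj]; ring
  show 0 < (X * conj Y).re
  rw [e, Complex.re_ofReal_mul, Complex.conj_re]
  exact mul_pos (Complex.normSq_pos.2 hX) hzre

/-- (3.19) tested on the vector `e_p`: `Re(a_kp conj a_lp) > 0`.
[cite: Dubois2009, proof of Prop. 3.3] -/
private theorem re_pos_single {n : ℕ} {A : Matrix (Fin n) (Fin n) ℂ}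
    (h : ∀ v ∈ rughCone n, v ≠ 0 → A.mulVec v ∈ rughConeInt n) (k l p : Fin n) :
    0 < (A k p * conj (A l p)).re := by
  classical
  have hv : (Pi.single p (1 : ℂ) : Fin n → ℂ) ∈ rughCone n := by
    intro i j
    simp only [Pi.single_apply]
    split_ifs <;> simp
  have hv0 : (Pi.single p (1 : ℂ) : Fin n → ℂ) ≠ 0 := by
    intro h0
    have := congrFun h0 p
    simp at this
  have := h _ hv hv0 k l
  simpa using this

/-- (3.19) tested on the vectors `α e_p + β e_q`, `Re(α β̄) ≥ 0`, `p ≠ q` (these lie in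
`ℂⁿ₊ ∖ 0`). [cite: Dubois2009, proof of Prop. 3.3, (3.14)] -/
private theorem re_pos_pair {n : ℕ} {A : Matrix (Fin n) (Fin n) ℂ}
    (h : ∀ v ∈ rughCone n, v ≠ 0 → A.mulVec v ∈ rughConeInt n) (k l : Fin n) {p q : Fin n}
    (hpq : p ≠ q) (α β : ℂ) (hne : α ≠ 0 ∨ β ≠ 0) (hαβ : 0 ≤ (α * conj β).re) :
    0 < ((A k p * α + A k q * β) * conj (A l p * α + A l q * β)).re := by
  classical
  set v : Fin n → ℂ := fun i => if i = p then α else if i = q then β else 0 with hv_def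
  have hvp : v p = α := by simp [hv_def]
  have hvq : v q = β := by simp [hv_def, Ne.symm hpq]
  have hv0 : v ≠ 0 := by
    intro h0
    rcases hne with hα | hβ
    · exact hα (by rw [← hvp, h0]; rfl)
    · exact hβ (by rw [← hvq, h0]; rfl)
  have hαβ' : 0 ≤ α.re * β.re + α.im * β.im := by
    have := hαβ
    simp only [Complex.mul_re, Complex.conj_re, Complex.conj_im] at this
    linarith
  have hv : v ∈ rughCone n := by
    intro i j
    simp only [hv_def]
    split_ifs <;>
      (simp only [Complex.mul_re, Complex.conj_re, Complex.conj_im, map_zero, mul_zero,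
          zero_mul, Complex.zero_re];
        try nlinarith [sq_nonneg α.re, sq_nonneg α.im, sq_nonneg β.re, sq_nonneg β.im])
  have hmv : ∀ i, A.mulVec v i = A i p * α + A i q * β := by
    intro i
    show ∑ j, A i j * v j = _
    rw [Fintype.sum_eq_add p q hpq]
    · rw [hvp, hvq]
    · rintro c ⟨hcp, hcq⟩
      simp [hv_def, hcp, hcq]
  have := h v hv hv0 k l
  rwa [hmv k, hmv l] at this

/-- The `2 × 2` core of (3.19) ⟹ (3.20): the disc `D̄_pq(λ_k, λ_l)` of (3.21) lies in the open
right half-plane as soon as (3.19) holds on the test vectors `α e_p + β e_q`.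
[cite: Dubois2009, Prop. 3.3, (3.21)] -/
private theorem cond_of_pair {xp xq yp yq : ℂ}
    (H : ∀ α β : ℂ, (α ≠ 0 ∨ β ≠ 0) → 0 ≤ (α * conj β).re →
      0 < ((xp * α + xq * β) * conj (yp * α + yq * β)).re) :
    ‖xp * yq - xq * yp‖ < (conj xp * yq + conj xq * yp).re := by
  -- Step 1: `Re(x_p conj y_p) > 0`, in particular `x_p ≠ 0`
  have h1 : 0 < (xp * conj yp).re := by
    have := H 1 0 (Or.inl one_ne_zero) (by simp)
    simpa using this
  have hxp : xp ≠ 0 := by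
    rintro rfl
    simp at h1
  -- Step 2 (Lemma 3.1 on two coordinates): `a = Re(x_p conj x_q) > 0`
  have ha : 0 < (xp * conj xq).re := by
    by_contra ha
    push Not at ha
    have hadm : 0 ≤ (xq * conj (-xp)).re := by
      have e : (xq * conj (-xp)).re = -(xp * conj xq).re := by
        simp only [Complex.mul_re, map_neg, Complex.neg_re, Complex.neg_im, Complex.conj_re,
          Complex.conj_im]
        ring
      rw [e]
      linarith
    have := H xq (-xp) (Or.inr (neg_ne_zero.2 hxp)) hadm
    have h0 : xp * xq + xq * -xp = 0 := by ring
    rw [h0, zero_mul, Complex.zero_re] at this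
    exact lt_irrefl _ this
  -- notation of (3.21): `a`, `d`, `E = conj x_p y_q + conj x_q y_p` (so `c_pq = E / 2a`),
  -- `D = x_p y_q − x_q y_p` (so `r_pq = |D| / 2a`)
  set a : ℝ := (xp * conj xq).re with ha_def
  set d : ℝ := (yp * conj yq).re with hd_def
  set E : ℂ := conj xp * yq + conj xq * yp with hE_def
  set D : ℂ := xp * yq - xq * yp with hD_def
  -- the test vector `(α, β) = (2a y_q − G x_q, G x_p − 2a y_p)` realises the value `z = G / 2a`
  have hX : ∀ G : ℂ, xp * (((2 * a : ℝ) : ℂ) * yq - G * xq) + xq * (G * xp - ((2 * a : ℝ) : ℂ) * yp)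
      = ((2 * a : ℝ) : ℂ) * D := by
    intro G; rw [hD_def]; ring
  have hY : ∀ G : ℂ, yp * (((2 * a : ℝ) : ℂ) * yq - G * xq) + yq * (G * xp - ((2 * a : ℝ) : ℂ) * yp)
      = G * D := by
    intro G; rw [hD_def]; ring
  have hnormD : Complex.normSq D = Complex.normSq E - 4 * a * d := by
    simp only [hD_def, hE_def, ha_def, hd_def, Complex.normSq_apply, Complex.mul_re,
      Complex.mul_im, Complex.add_re, Complex.add_im, Complex.sub_re, Complex.sub_im,
      Complex.conj_re, Complex.conj_im]
    ring
  have hadm : ∀ G : ℂ, ((((2 * a : ℝ) : ℂ) * yq - G * xq) * conj (G * xp - ((2 * a : ℝ) : ℂ) * yp)).re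
      = 2 * a * (conj G * E).re - 4 * a ^ 2 * d - a * Complex.normSq G := by
    intro G
    simp only [hE_def, ha_def, hd_def, Complex.normSq_apply, Complex.mul_re, Complex.mul_im,
      Complex.add_re, Complex.add_im, Complex.sub_re, Complex.sub_im, Complex.conj_re,
      Complex.conj_im, map_sub, map_mul, Complex.conj_ofReal, Complex.ofReal_re,
      Complex.ofReal_im]
    ring
  have hval : ∀ G : ℂ, ((((2 * a : ℝ) : ℂ) * D) * conj (G * D)).re
      = 2 * a * Complex.normSq D * G.re := by
    intro G
    simp only [Complex.normSq_apply, Complex.mul_re, Complex.mul_im, map_mul, Complex.conj_re,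
      Complex.conj_im, Complex.ofReal_re, Complex.ofReal_im]
    ring
  -- Step 3: `Re E > 0` (i.e. `Re c_pq > 0`), testing `z = c_pq`
  have hEre : 0 < E.re := by
    by_cases hD0 : D = 0
    · -- degenerate disc: `y = (y_p/x_p) x` on the two coordinates
      have iden : Complex.normSq xp * E.re = 2 * a * (xp * conj yp).re + (conj xp ^ 2 * D).re := by
        simp only [hE_def, hD_def, ha_def, Complex.normSq_apply, Complex.mul_re, Complex.mul_im,
          Complex.add_re, Complex.sub_re, Complex.sub_im, Complex.conj_re, Complex.conj_im,
          pow_two]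
        ring
      rw [hD0, mul_zero, Complex.zero_re, add_zero] at iden
      have hpos : 0 < Complex.normSq xp * E.re := by
        rw [iden]; exact mul_pos (mul_pos two_pos ha) h1
      exact (mul_pos_iff_of_pos_left (Complex.normSq_pos.2 hxp)).1 hpos
    · have hne : (((2 * a : ℝ) : ℂ) * yq - E * xq) ≠ 0 ∨ (E * xp - ((2 * a : ℝ) : ℂ) * yp) ≠ 0 := by
        by_contra hboth
        push Not at hboth
        have e := hX E
        rw [hboth.1, hboth.2, mul_zero, mul_zero, zero_add] at e
        rcases mul_eq_zero.1 e.symm with h0 | h0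
        · have : (2 * a : ℝ) = 0 := by exact_mod_cast h0
          linarith
        · exact hD0 h0
      have hadmE : 0 ≤ ((((2 * a : ℝ) : ℂ) * yq - E * xq) * conj (E * xp - ((2 * a : ℝ) : ℂ) * yp)).re := by
        rw [hadm E, ← Complex.normSq_eq_conj_mul_self, Complex.ofReal_re]
        have h0 := mul_nonneg ha.le (Complex.normSq_nonneg D)
        rw [hnormD] at h0
        linarith
      have := H _ _ hne hadmE
      rw [hX E, hY E, hval E] at this
      exact (mul_pos_iff_of_pos_left (mul_pos (mul_pos two_pos ha) (Complex.normSq_pos.2 hD0))).1 this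
  -- Step 4: `(Im E)² < 4ad` (i.e. `(Re c_pq)² > r_pq²`), testing `z = i Im c_pq`
  have h4 : E.im ^ 2 < 4 * a * d := by
    by_contra hcon
    push Not at hcon
    set F : ℂ := ((E.im : ℝ) : ℂ) * Complex.I with hF_def
    have hFre : F.re = 0 := by simp [hF_def]
    have hFim : F.im = E.im := by simp [hF_def]
    have hne : (((2 * a : ℝ) : ℂ) * yq - F * xq) ≠ 0 ∨ (F * xp - ((2 * a : ℝ) : ℂ) * yp) ≠ 0 := by
      refine Or.inr fun hβ => ?_
      have hre := congrArg Complex.re hβ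
      have him := congrArg Complex.im hβ
      simp only [Complex.sub_re, Complex.sub_im, Complex.mul_re, Complex.mul_im, hFre, hFim,
        Complex.ofReal_re, Complex.ofReal_im, Complex.zero_re, Complex.zero_im, zero_mul,
        sub_zero, zero_sub, zero_add] at hre him
      have h1' : 0 < xp.re * yp.re + xp.im * yp.im := by
        have := h1
        simp only [Complex.mul_re, Complex.conj_re, Complex.conj_im] at this
        linarith
      have hzero : 2 * a * (xp.re * yp.re + xp.im * yp.im) = 0 := by
        linear_combination (-xp.re) * hre + (-xp.im) * him
      have := mul_pos (mul_pos two_pos ha) h1'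
      linarith
    have hadmF : 0 ≤ ((((2 * a : ℝ) : ℂ) * yq - F * xq) * conj (F * xp - ((2 * a : ℝ) : ℂ) * yp)).re := by
      rw [hadm F]
      have e : 2 * a * (conj F * E).re - 4 * a ^ 2 * d - a * Complex.normSq F
          = a * (E.im ^ 2 - 4 * a * d) := by
        rw [Complex.normSq_apply, Complex.mul_re, Complex.conj_re, Complex.conj_im, hFre, hFim]
        ring
      rw [e]
      exact mul_nonneg ha.le (sub_nonneg.2 hcon)
    have := H _ _ hne hadmF
    rw [hX F, hY F, hval F, hFre, mul_zero] at this
    exact lt_irrefl _ this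
  -- conclusion: `|D|² = |E|² − 4ad < (Re E)²`
  have hsq : ‖D‖ ^ 2 < E.re ^ 2 := by
    rw [Complex.sq_norm, hnormD, Complex.normSq_apply]
    nlinarith [h4]
  exact (sq_lt_sq₀ (norm_nonneg _) hEre.le).1 hsq

/-- **Dubois 2009, Theorem 1.1 (first assertion) = Proposition 3.3**, discharged: a complex
`n × n` matrix maps `ℂⁿ₊ ∖ 0` into `Int ℂⁿ₊` iff (3.20) holds for all indices.
[cite: Dubois2009, Thm 1.1, Prop. 3.3, (3.19)–(3.21); Lemmas 3.1–3.2] -/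
theorem Dubois2009_thm_1_1_iff_holds : Dubois2009_thm_1_1_iff := by
  intro n A
  constructor
  · intro h k l p q
    by_cases hpq : p = q
    · subst hpq
      have h1 := re_pos_single h k l p
      rw [sub_self, norm_zero]
      simp only [Complex.add_re, Complex.mul_re, Complex.conj_re, Complex.conj_im] at h1 ⊢
      linarith
    · exact cond_of_pair fun α β hne hαβ => re_pos_pair h k l hpq α β hne hαβ
  · exact mapsTo_of_cond

end ProofOfProp33

end Literature.Dynamics.Contraction

end
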